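import Summits.Ventures.HSemireg.ParitySieveOneFactor
import HarnessLib

/-!
# Venture HSemireg — THEOREM (B-XIX)(b) AT n = 4 (g = 8, family B), TWO FACTORS: the BORDER SIEVE on character matrices `(v_ij)`
# is `S₄ = border-𝒫₄` EXACTLY — stability under every generator AND maximality, both in the kernel (the MENU LAW (c) and the box
# readings (d) are the companion `ParitySieveMenuLaw.lean`) — kernel statements of integer ∕ `𝔽₂` linear algebra

HONEST FRAMING. Part of the Lean index of the computation cell `pub-hsemireg` (Sunday typer seat p9, § g = 8; companion of
`CensusG8Table.lean` ∕ `CensusG8Verdict.lean`, census row **B19-21**; first part = `ParitySieveOneFactor.lean`, whose vocabulary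
`sieve ∕ T ∕ Phi ∕ thetaMul` is used; third part = `ParitySieveMenuLaw.lean`). FINITE ARITHMETIC ONLY: integer matrices
`Fin 5 → Fin 5 → ℤ` («two-factor characters `Σ v_ij u_i(Θ_x) u_j(Θ_y)` of objects on a product `X₁ × X₂` of ppav FOURFOLDS»), parity
conditions on their four border lines, and explicit (bi)linear operations. No variety, sheaf, slice, projection, Fourier–Mukai
functor or semiregularity map is constructed; the hypothesis (I1) is NOT a binder of any theorem here;
nothing here says that HC ∕ HC_CM ∕ HC_AV holds; no object is certified; no
Literature fact is declared. Numbers, not adjectives.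

TEXTS OF RECORD (quoted, not interpreted). Source: t-19 g7, `target-g8/BISECANT-G8-t19g7.md` v1.3 `68df8c98ce5a70b7` §2 (b) and
§3; census row B19-21 of `target-g8/CENSUS.md` v1.274 `7744dc4867915f69`; STRUCTURE.md v1.0 §2 (B-XIX) NOTE (v0.46); starting point
t-19 g7's folder-local `target-g8/t19g7/lean/TwoFactorSieve.lean` `1f2b1f702b73cbf4` (`border_T1 … border_neg`, `border_interior_free`,
`menuLaw_mod2`, `boxCells_fail`; farm rc 0 ×2 seats), §1 (I4): «the two-factor S₄ is `paritySieve` imposed on the four border lines of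
the 5 × 5 coefficient matrix … (a `twoFactorSieve` decl + its ⟨T₁,T₂,Φ₁,Φ₂⟩-stability is a half-page port of the existing lemmas)».
* (B-XIX)(b): «If (I1)_{X₁} and (I1)_{X₂} hold then for every G ∈ D^b(X₁ × X₂): (v mod 2) ∈ S_n := the largest 𝔽₂-subspace of
  {v̄ : column 0 ∈ 𝒫_n and row 0 ∈ 𝒫_n} stable under T₁, T₂, Φ₁, Φ₂, swap, and v̄ ↦ M(n̄)v̄, v̄ ↦ v̄M(n̄)ᵀ for n̄ ∈ R_n. PROOF: column 0
  of v = ch(Li_y^* G) for the slice i_y : X₁ × {y} ↪ X₁ × X₂ (i_y^* u_ij = u_i if j = 0, else 0), an object on X₁ ⇒ (a); row 0 likewise;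
  each listed map is induced by an autoequivalence or by ⊗ p₂^*N with N an object … ∎ … S₄ = BORDER-𝒫₄ EXACTLY: the eight conditions
  v₁₀≡v₂₀≡v₃₀, v₀₁≡v₀₂≡v₀₃, v₁₄≡v₂₄≡v₃₄, v₄₁≡v₄₂≡v₄₃ (dim 17∕25; hand proof §3, machine closure identical); the nine interior coordinates
  v_ij, 1 ≤ i,j ≤ 3, are UNCONSTRAINED at n = 4 (every functorial operation reaches them with a factor C(4,j) ∈ {4,6})». On X₁ × X₂:
  «T₁ = P·v, T₂ = v·Pᵀ, Φ₁ = J·v, Φ₂ = v·J (J antidiagonal ±1), swap v ↦ vᵀ, twist by N ∈ D^b(X₂): v ↦ v·M(n̄)ᵀ».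
  §3: «NECESSITY of the eight conditions: column 0 ∕ row 0 = slices; column 4 = ch(Rp₁_* G) (∫_{X₂} picks the u_{i4}-coefficients),
  row 4 = ch(Rp₂_* G); each is the character of an object on a factor ⇒ ∈ 𝒫₄. SUFFICIENCY (the border subspace B := {col 0, col 4,
  row 0, row 4 ∈ 𝒫₄} is stable under every generator, hence equals S₄): T₁ = P· acts on each column by the binomial transform, which
  preserves 𝒫₄, and replaces row i by Σ_k C(i,k) row_k: row 0 ↦ row 0, row 4 ↦ … ≡ row 0 + row 4 … Φ₁ = J· maps each column by Φ and
  permutes rows 0 ↔ 4 up to sign. Twist by n̄ ∈ R₄ = 𝒫₄ in factor 1: each column v_{·j} ↦ v_{·j} ∗ n̄ …; rows: row 0 ↦ n̄₀·row 0 and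
  row 4 ↦ n̄₄·row 0 + n̄₀·row 4 (mod 2). T₂, Φ₂, factor-2 twists by symmetry; swap exchanges the two pairs of conditions. ∎ The
  interior 3 × 3 block is free: 25 − 8 = 17 = dim S₄».

WHAT THIS FILE PROVES (kernel). `border` (the eight conditions) and `basic` (column 0, row 0 only); STABILITY of `border` under
`T1 T2 Phi1 Phi2 swap` (as iffs), under `twist1 ∕ twist2` by EVERY sieved `n̄` (via `ParitySieve.sieve_thetaMul`; rows by
`row_twist1_zero` ∕ `row_twist1_four`, whose even coefficients `4, 6, 4` are «WHY NO INTERIOR CONDITION CAN EXIST AT n = 4»), under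
`+`, `−`, and for every even matrix; INTERIOR FREE (`border_congr_border`, `border_interior`); MAXIMALITY (`border_of_phiStable`: every
predicate contained in `basic` and stable under `Phi1`, `Phi2` is contained in `border`) and the packaging `border_iff_exists_stable` —
together «S₄ = border-𝒫₄ EXACTLY» with BOTH inclusions in the kernel (the folder-local file had the stability of the generators one by
one); and the invertibility half `border_twist1_iff` ∕ `border_twist2_iff` (twists by sieved UNITS — `n̄₀` odd, e.g. `e^{aΘ}` — do not
change the verdict, «S₄ is stable»).

WHAT IS NOT HERE. The DICTIONARY (slices, `Rp_{i*}`, relative Fourier–Mukai, line-bundle twists, GRR with td = 1, (I1) and its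
«very general» seat-inference sentence) — prose of record, not asserted; `S_n` for n ≥ 5 (interior conditions appear at n = 5, 6, 7;
`runs/sieve2.log`); the MENU LAW and box readings (`ParitySieveMenuLaw.lean`); (B-XIX)(e) (the FLAG) and (B-XX); the quadratic
(non-linear-in-G) operations of §2 REMARK (iii); «𝔽₂-subspace» is rendered as «predicate closed under `+`, `−` and even matrices» (no
`Submodule (ZMod 2)` structure is built). Everything here is at n = 4 only.
-/

namespace Summit.Ventures.HSemireg.ParitySieve

/-! ## §2 Two factors: the border sieve on character matrices `v = (v_ij)`, `ch = Σ v_ij u_i(Θ_x) u_j(Θ_y)` -/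

/-- Column `j` of a character matrix: `i ↦ v i j` (column 0 = «ch of the slice `Li_y^* G`», column 4 = «ch(Rp₁_* G)» in the
dictionary). [bookkeeping] -/
def col (v : Fin 5 → Fin 5 → ℤ) (j : Fin 5) : Fin 5 → ℤ := fun i => v i j

/-- Row `i` of a character matrix: `j ↦ v i j` (row 0 = slice in the other factor, row 4 = «ch(Rp₂_* G)»). [bookkeeping] -/
def row (v : Fin 5 → Fin 5 → ℤ) (i : Fin 5) : Fin 5 → ℤ := fun j => v i j

/-- **The two-factor BORDER SIEVE `border-𝒫₄`** ((B-XIX)(b) at n = 4): the one-factor sieve on the four border lines column 0,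
column 4, row 0, row 4 — «the eight conditions v₁₀≡v₂₀≡v₃₀, v₀₁≡v₀₂≡v₀₃, v₁₄≡v₂₄≡v₃₄, v₄₁≡v₄₂≡v₄₃». A decidable predicate of the
finite model, not a fact. [bookkeeping; transcription of BISECANT-G8-t19g7.md §2 (b) ∕ t-19 g7 `border`] -/
def border (v : Fin 5 → Fin 5 → ℤ) : Prop :=
  sieve (col v 0) ∧ sieve (col v 4) ∧ sieve (row v 0) ∧ sieve (row v 4)

/-- The border sieve is decidable (eight integer congruences). [bookkeeping] -/
instance (v : Fin 5 → Fin 5 → ℤ) : Decidable (border v) := inferInstanceAs (Decidable (_ ∧ _))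

/-- The BASIC set of (B-XIX)(b): «{v̄ : column 0 ∈ 𝒫_n and row 0 ∈ 𝒫_n}» (the two slice conditions), inside which `S₄` is the largest
stable subspace. A predicate of the finite model, not a fact. [bookkeeping; transcription] -/
def basic (v : Fin 5 → Fin 5 → ℤ) : Prop := sieve (col v 0) ∧ sieve (row v 0)

/-- `T₁ = P·v`: twist by `p₁^*𝒪(Θ_x)`, the binomial transform on every column. [bookkeeping; transcription] -/
def T1 (v : Fin 5 → Fin 5 → ℤ) : Fin 5 → Fin 5 → ℤ := fun i j => T (col v j) i

/-- `T₂ = v·Pᵀ`: twist by `p₂^*𝒪(Θ_y)`, the binomial transform on every row. [bookkeeping; transcription] -/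
def T2 (v : Fin 5 → Fin 5 → ℤ) : Fin 5 → Fin 5 → ℤ := fun i j => T (row v i) j

/-- `Φ₁ = J·v`: relative Fourier–Mukai along the first factor, `Φ` on every column. [bookkeeping; transcription] -/
def Phi1 (v : Fin 5 → Fin 5 → ℤ) : Fin 5 → Fin 5 → ℤ := fun i j => Phi (col v j) i

/-- `Φ₂ = v·J`: relative Fourier–Mukai along the second factor, `Φ` on every row. [bookkeeping; transcription] -/
def Phi2 (v : Fin 5 → Fin 5 → ℤ) : Fin 5 → Fin 5 → ℤ := fun i j => Phi (row v i) j

/-- `swap v = vᵀ` (exchange of the two factors). [bookkeeping; transcription] -/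
def swap (v : Fin 5 → Fin 5 → ℤ) : Fin 5 → Fin 5 → ℤ := fun i j => v j i

/-- Twist by `p₁^* N`, `ch N = n̄`, along the FIRST factor: every column `v_{·j} ↦ n̄ ⋆ v_{·j}` («the ring structure
(v∗n̄)_i = Σ_k C(i,k) v_k n̄_{i−k}» of §3). [bookkeeping; transcription] -/
def twist1 (n : Fin 5 → ℤ) (v : Fin 5 → Fin 5 → ℤ) : Fin 5 → Fin 5 → ℤ := fun i j => thetaMul n (col v j) i

/-- Twist by `p₂^* N` along the SECOND factor: every row `v_{i·} ↦ n̄ ⋆ v_{i·}` (the text's `v ↦ v·M(n̄)ᵀ`). [bookkeeping;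
transcription] -/
def twist2 (n : Fin 5 → ℤ) (v : Fin 5 → Fin 5 → ℤ) : Fin 5 → Fin 5 → ℤ := fun i j => thetaMul n (row v i) j

/-- The external (box ∕ Künneth) product of two one-factor characters: `(x ⊗ y)_ij = x_i y_j` (`ch(F₁ ⊠ F₂)`). [bookkeeping;
transcription] -/
def tensor (x y : Fin 5 → ℤ) : Fin 5 → Fin 5 → ℤ := fun i j => x i * y j

section TwoFactor

variable (v w : Fin 5 → Fin 5 → ℤ) (n x y : Fin 5 → ℤ)

/-- `border ⊆ basic`. [bookkeeping] -/
theorem basic_of_border (h : border v) : basic v := ⟨h.1, h.2.2.1⟩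

/-- NECESSITY direction as recorded by t-19 g7 (`border_of_slices`): the border holds as soon as the one-factor sieve holds for the
four border lines (slices and projections) — a tautology kept for the dictionary. [bookkeeping] -/
theorem border_of_lines (h0 : sieve (col v 0)) (h4 : sieve (col v 4)) (r0 : sieve (row v 0)) (r4 : sieve (row v 4)) :
    border v :=
  ⟨h0, h4, r0, r4⟩

/-- **STABILITY under `T₁`** (as an iff: `P̄` is an involution mod 2). [bookkeeping; linear parities by `omega`] -/
theorem border_T1_iff : border (T1 v) ↔ border v := by
  simp only [border, sieve, col, row, T1, T, Matrix.cons_val_zero, Matrix.cons_val_one, Matrix.head_cons,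
    Matrix.cons_val_two, Matrix.tail_cons, Matrix.cons_val_three, Matrix.cons_val_four]
  omega

/-- **STABILITY under `T₂`.** [bookkeeping] -/
theorem border_T2_iff : border (T2 v) ↔ border v := by
  simp only [border, sieve, col, row, T2, T, Matrix.cons_val_zero, Matrix.cons_val_one, Matrix.head_cons,
    Matrix.cons_val_two, Matrix.tail_cons, Matrix.cons_val_three, Matrix.cons_val_four]
  omega

/-- **STABILITY under `Φ₁`** (column `Φ`, rows 0 ↔ 4 up to sign). [bookkeeping] -/
theorem border_Phi1_iff : border (Phi1 v) ↔ border v := by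
  simp only [border, sieve, col, row, Phi1, Phi, Matrix.cons_val_zero, Matrix.cons_val_one, Matrix.head_cons,
    Matrix.cons_val_two, Matrix.tail_cons, Matrix.cons_val_three, Matrix.cons_val_four]
  omega

/-- **STABILITY under `Φ₂`.** [bookkeeping] -/
theorem border_Phi2_iff : border (Phi2 v) ↔ border v := by
  simp only [border, sieve, col, row, Phi2, Phi, Matrix.cons_val_zero, Matrix.cons_val_one, Matrix.head_cons,
    Matrix.cons_val_two, Matrix.tail_cons, Matrix.cons_val_three, Matrix.cons_val_four]
  omega

/-- **STABILITY under `swap`** (exchanges the two pairs of conditions). [bookkeeping] -/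
theorem border_swap_iff : border (swap v) ↔ border v := by
  simp only [border, sieve, col, row, swap]
  omega

/-- `border` is a subgroup: closed under `+`. [bookkeeping] -/
theorem border_add (hv : border v) (hw : border w) : border (v + w) := by
  simp only [border, sieve, col, row, Pi.add_apply] at hv hw ⊢
  omega

/-- `border` is closed under `−`. [bookkeeping] -/
theorem border_neg (hv : border v) : border (-v) := by
  simp only [border, sieve, col, row, Pi.neg_apply] at hv ⊢
  omega

/-- `border` is closed under subtraction. [bookkeeping] -/
theorem border_sub (hv : border v) (hw : border w) : border (v - w) := by
  simp only [border, sieve, col, row, Pi.sub_apply] at hv hw ⊢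
  omega

/-- `2 • v` passes the border sieve for every `v` (the sieve reads residues). [bookkeeping] -/
theorem border_two_smul : border ((2 : ℤ) • v) := by
  simp only [border, sieve, col, row, Pi.smul_apply, smul_eq_mul]
  omega

/-- Row 0 of the factor-1 twist: `row (n̄ ⋆₁ v) 0 = n̄₀ · row v 0` («row 0 ↦ n̄₀·row 0»). [bookkeeping] -/
theorem row_twist1_zero : row (twist1 n v) 0 = n 0 • row v 0 := by
  funext j
  simp [row, col, twist1, thetaMul]

/-- Row 4 of the factor-1 twist: `n̄₀·row 4 + n̄₄·row 0 +` EVEN multiples of the interior rows («row 4 ↦ n̄₄·row 0 + n̄₀·row 4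
(mod 2)»; the coefficients `C(4,1) = C(4,3) = 4`, `C(4,2) = 6` are even — «WHY NO INTERIOR CONDITION CAN EXIST AT n = 4»).
[bookkeeping] -/
theorem row_twist1_four :
    row (twist1 n v) 4 = n 0 • row v 4 + n 4 • row v 0 +
      (2 : ℤ) • ((2 * n 1) • row v 3 + (3 * n 2) • row v 2 + (2 * n 3) • row v 1) := by
  funext j
  simp [row, col, twist1, thetaMul]
  ring

/-- **STABILITY under twists by ANY sieved character along the first factor** (`n̄ ∈ 𝒫₄ = R₄`; columns by `sieve_thetaMul`, rows by
`row_twist1_zero` ∕ `row_twist1_four`). This is the generator «v̄ ↦ M(n̄)v̄ for n̄ ∈ R_n» of (B-XIX)(b) in full, not only for `e^Θ` and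
`pt`. [bookkeeping; kernel form of the §3 SUFFICIENCY sentence] -/
theorem border_twist1 (hn : sieve n) (hv : border v) : border (twist1 n v) := by
  obtain ⟨h0, h4, r0, r4⟩ := hv
  refine ⟨sieve_thetaMul hn h0, sieve_thetaMul hn h4, ?_, ?_⟩
  · rw [row_twist1_zero]; exact sieve_smul _ _ r0
  · rw [row_twist1_four]
    exact sieve_add _ _ (sieve_add _ _ (sieve_smul _ _ r4) (sieve_smul _ _ r0)) (sieve_two_smul _)

/-- The factor-2 twist is the factor-1 twist conjugated by `swap`. [bookkeeping] -/
theorem twist2_eq_swap_twist1_swap : twist2 n v = swap (twist1 n (swap v)) := rfl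

/-- **STABILITY under twists by any sieved character along the second factor.** [bookkeeping] -/
theorem border_twist2 (hn : sieve n) (hv : border v) : border (twist2 n v) := by
  rw [twist2_eq_swap_twist1_swap, border_swap_iff]
  exact border_twist1 _ _ hn ((border_swap_iff v).mpr hv)

/-- The point-class twists of t-19 g7 (`Mpt1`, `Mpt2`) are the instances `n̄ = pt`; the line-bundle twists `T₁`, `T₂` are
the instances `n̄ = e^Θ`: `twist1 e^Θ = T1`. [bookkeeping] -/
theorem twist1_expTheta : twist1 expTheta v = T1 v := by
  funext i j
  simp only [twist1, T1]
  rw [thetaMul_expTheta]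

/-- **Twists by sieved UNITS along the first factor do not change the verdict** (`n̄` sieved, `n̄₀` odd — e.g. `e^{aΘ_x}`): columns by
`sieve_thetaMul_iff_of_unit`, row 0 by `sieve_smul_iff_of_odd`, row 4 by peeling off the sieved part `n̄₄·row 0 + 2·(…)`. This is the
text's «Twists (a,b) … do not change the verdict (S₄ is stable)» with the invertibility made explicit. [bookkeeping] -/
theorem border_twist1_iff (hn : sieve n) (h0 : n 0 % 2 = 1) : border (twist1 n v) ↔ border v := by
  refine ⟨fun h => ?_, fun h => border_twist1 _ _ hn h⟩
  obtain ⟨c0, c4, r0, r4⟩ := h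
  have hc0 : sieve (col v 0) := (sieve_thetaMul_iff_of_unit hn h0 _).mp c0
  have hc4 : sieve (col v 4) := (sieve_thetaMul_iff_of_unit hn h0 _).mp c4
  rw [row_twist1_zero] at r0
  have hr0 : sieve (row v 0) := (sieve_smul_iff_of_odd _ (n 0) h0).mp r0
  rw [row_twist1_four, add_assoc] at r4
  have hX : sieve (n 4 • row v 0 + (2 : ℤ) • ((2 * n 1) • row v 3 + (3 * n 2) • row v 2 + (2 * n 3) • row v 1)) :=
    sieve_add _ _ (sieve_smul _ (n 4) hr0) (sieve_two_smul _)
  have h4 := sieve_sub _ _ r4 hX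
  rw [add_sub_cancel_right] at h4
  exact ⟨hc0, hc4, hr0, (sieve_smul_iff_of_odd _ (n 0) h0).mp h4⟩

/-- The same along the second factor. [bookkeeping] -/
theorem border_twist2_iff (hn : sieve n) (h0 : n 0 % 2 = 1) : border (twist2 n v) ↔ border v := by
  rw [twist2_eq_swap_twist1_swap, border_swap_iff, border_twist1_iff _ _ hn h0, border_swap_iff]

/-- **INTERIOR FREE:** the border sieve depends only on the sixteen border entries — two matrices that agree on the border have the
same verdict («the nine interior coordinates v_ij, 1 ≤ i,j ≤ 3, are UNCONSTRAINED at n = 4»; dim 17∕25). [bookkeeping] -/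
theorem border_congr_border (h : ∀ i j : Fin 5, (i = 0 ∨ i = 4 ∨ j = 0 ∨ j = 4) → v i j = w i j) :
    border v ↔ border w := by
  simp only [border, sieve, col, row, h 1 0 (by decide), h 2 0 (by decide), h 3 0 (by decide), h 1 4 (by decide),
    h 2 4 (by decide), h 3 4 (by decide), h 0 1 (by decide), h 0 2 (by decide), h 0 3 (by decide), h 4 1 (by decide),
    h 4 2 (by decide), h 4 3 (by decide)]

/-- t-19 g7's `border_interior_free`: any matrix supported on the interior 3 × 3 block passes. [bookkeeping] -/
theorem border_interior (a b c d e f g h k : ℤ) :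
    border ![![0, 0, 0, 0, 0], ![0, a, b, c, 0], ![0, d, e, f, 0], ![0, g, h, k, 0], ![0, 0, 0, 0, 0]] := by
  simp only [border, sieve, col, row, Matrix.cons_val_zero, Matrix.cons_val_one, Matrix.head_cons,
    Matrix.cons_val_two, Matrix.tail_cons, Matrix.cons_val_three, Matrix.cons_val_four]
  decide

/-- Column 0 of `Φ₂ v` is column 4 of `v` (relative Fourier–Mukai moves the projection line onto the slice line). [bookkeeping] -/
theorem col_Phi2_zero : col (Phi2 v) 0 = col v 4 := by
  funext i; simp [col, row, Phi2, Phi]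

/-- Row 0 of `Φ₁ v` is row 4 of `v`. [bookkeeping] -/
theorem row_Phi1_zero : row (Phi1 v) 0 = row v 4 := by
  funext j; simp [col, row, Phi1, Phi]

/-- **MAXIMALITY («hence equals S₄»): every predicate contained in the BASIC set and stable under `Φ₁` and `Φ₂` is contained in
`border`.** With the stability theorems above this is «S₄ = border-𝒫₄ EXACTLY» in the kernel: `border` is itself such a predicate
(and is moreover stable under `T₁, T₂, swap`, all sieved twists, `±`), and no predicate with these two stabilities inside `basic` is
larger. Proof: `Φ₂` carries column 4 onto column 0 and `Φ₁` carries row 4 onto row 0. [bookkeeping; kernel form of the §3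
NECESSITY∕SUFFICIENCY pair] -/
theorem border_of_phiStable (S : (Fin 5 → Fin 5 → ℤ) → Prop) (hS : ∀ u, S u → basic u)
    (h1 : ∀ u, S u → S (Phi1 u)) (h2 : ∀ u, S u → S (Phi2 u)) {u : Fin 5 → Fin 5 → ℤ} (hu : S u) : border u := by
  refine ⟨(hS u hu).1, ?_, (hS u hu).2, ?_⟩
  · rw [← col_Phi2_zero]; exact (hS _ (h2 u hu)).1
  · rw [← row_Phi1_zero]; exact (hS _ (h1 u hu)).2

/-- **«S₄ = border-𝒫₄ EXACTLY», packaged:** `v` passes the border sieve iff `v` lies in SOME sub-predicate of the basic set that is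
stable under `Φ₁` and `Φ₂` (the largest such being `border` itself, which is also stable under every other generator of (B-XIX)(b)).
[bookkeeping] -/
theorem border_iff_exists_stable :
    border v ↔ ∃ S : (Fin 5 → Fin 5 → ℤ) → Prop,
      S v ∧ (∀ u, S u → basic u) ∧ (∀ u, S u → S (Phi1 u)) ∧ (∀ u, S u → S (Phi2 u)) := by
  constructor
  · intro h
    exact ⟨border, h, fun u hu => basic_of_border u hu, fun u hu => (border_Phi1_iff u).mpr hu,
      fun u hu => (border_Phi2_iff u).mpr hu⟩
  · rintro ⟨S, hS, hb, h1, h2⟩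
    exact border_of_phiStable S hb h1 h2 hS

end TwoFactor

end Summit.Ventures.HSemireg.ParitySieve
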